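import Literature.AlgebraicGeometry.Motives.HodgeThetaSubalgebraSymplecticRankFour
import Literature.AlgebraicGeometry.Motives.HodgeLieRealPlacesSl2
import Literature.AlgebraicGeometry.Motives.ZarhinHodgeGroupPositivity
import HarnessLib

/-!
# `Lie Hg ⊗ ℂ` restricts ONTO `𝔰𝔭(T_σ)` on every four-dimensional real eigenblock of the Hodge endomorphisms
# (Moonen–Zarhin 1995/1999, Type I(e) with `dim_E H¹ = 4`: `Hg = R_{E/ℚ} Sp_{4,E}` — the per-place step)

Family `hodge`, layer `Literature/AlgebraicGeometry/Motives` (abstract polarizable `ℚ`-Hodge structures; no geometry); THEOREMS ONLY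
(no definition, no named fact; D-0026).  Research context: cell `pub-hodgecm2` (COR-CM), seat `b27`, count-neutral lane MT-RANK
ladder: the first step of the rung `t = 10e + 1` for REAL MULTIPLICATION OF RELATIVE DIMENSION TWO (`End⁰B = E` totally real of
degree `e`, `dim B = 2e`), the `𝔰𝔭₄`-analogue of the tree's `𝔰𝔩₂`-theorem `HodgeLieRealPlacesSl2` (relative dimension one,
Ribet/Hazama).  UNCONDITIONAL; nothing here uses or asserts HC_CM.

SETTING.  `H` an effective polarized `ℚ`-Hodge structure of weight `1` on a finite-dimensional `V`, `ψ` a polarization for which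
every Hodge endomorphism is `ψ`-self-adjoint, `σ_i : End_Hdg(V) → ℂ` (`i ∈ ι`) REAL characters whose blocks `T_i = H.eigenBlock (σ i)`
form an internal direct sum `V_ℂ = ⊕_i T_i` and are FOUR-dimensional.  Then (§1) the blocks are pairwise `ψ_ℂ`-orthogonal, so `ψ_ℂ`
restricts to a non-degenerate alternating form `ω_i` on `T_i`; (§2) each `T_i` is real and `Θ`-graded with planes
`T_i ∩ V^{1,0}`, `T_i ∩ V^{0,1}`; (§3) every `Lie Hg ⊗ ℂ`-stable subspace of `T_i` is `0` or `T_i` (the tree's positivity theorem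
`eq_bot_or_forall_mem_of_hodgeLieC_stable`); hence (§4) the tree's CORE theorem `SymplecticTheta.core_of_irreducible` (for `T = ±Θ|_{T_i}`)
applied to the Lie algebra of restrictions `{Y|_{T_i} : Y ∈ Lie Hg ⊗ ℂ} ⊆ 𝔰𝔭(T_i, ω_i)` gives ALL of `𝔰𝔭(T_i, ω_i)`:

* **`SymplecticBlocks.exists_mem_hodgeLieC_restrict_eq`** — for every `i` and every `ω_i`-skew `ℂ`-linear `g : T_i → T_i` there is
  `Y ∈ Lie Hg(H) ⊗ ℂ` with `Y|_{T_i} = g`.  (Moonen–Zarhin 1995, simple fourfolds of Type I(2): «`Hg(X) = R_{F/ℚ} Sp_{F}(V, ψ)`»,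
  and 1999 (2.2) for the shape of the statement; the only proper irreducible subalgebra of `𝔰𝔭₄` would be the principal `𝔰𝔩₂`,
  which cannot contain an involution with two-dimensional eigenspaces — the core theorem packages this.)

The assembly over the places (Goursat for the rigid factors `𝔰𝔭(T_i)`, `Lie Hg ⊗ ℂ = ⊕_i 𝔰𝔭(T_i)`, `dim Lie Hg = 10·#ι`) is the sequel.

## References

* [MoonenZarhin1995Duke] B. Moonen, Yu. G. Zarhin, *Hodge classes and Tate classes on simple abelian fourfolds*, Duke Math. J. 77
  (1995) 553–581 (Type I(2): `Hg = R_{F/ℚ} Sp_F(V, ψ)`). [cite: MoonenZarhin1995Duke, Type I(2)]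
* [MoonenZarhin1999LowDim] B. Moonen, Yu. G. Zarhin, Math. Ann. 315 (1999), (2.2)–(2.3), §3 (3.1). [cite: MoonenZarhin1999LowDim, §2 (2.2) and §3 (3.1)]
* [GoodmanWallachGTM255] R. Goodman, N. Wallach, GTM 255, §2.1.2 (Siegel block form of `𝔰𝔭`). [cite: GoodmanWallachGTM255, §2.1.2]
* [Zarhin1983HodgeGroupsK3] Yu. G. Zarhin, J. reine angew. Math. 341 (1983), §2 (blocks of `End_Hdg`; irreducibility by positivity).
  [cite: Zarhin1983HodgeGroupsK3, §2]
* [Hazama1983] F. Hazama, Tôhoku Math. J. 35 (1983), §3 (p. 305) (the blocks `V_i` and the restricted symplectic forms). [cite: Hazama1983, §3 (p. 305)]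
-/

noncomputable section

open scoped TensorProduct

namespace Literature.AlgebraicGeometry.Motives

namespace HodgeStructure

universe u

variable {V : Type u} [AddCommGroup V] [Module ℚ V] [Module.Finite ℚ V] [HodgeTensorFacts.{u, u}] {n : ℤ}
variable {ι : Type*} [DecidableEq ι]

/-! ### §1 The restricted form `ω_i = ψ_ℂ|_{T_i}` is non-degenerate -/

omit [Module.Finite ℚ V] [HodgeTensorFacts.{u, u}] in
/-- **`ψ_ℂ` is non-degenerate on each block**: a vector of `T_i` orthogonal to `T_i` is orthogonal to every block (blocks of distinct
characters are orthogonal when `End_Hdg` is self-adjoint), hence to `V_ℂ = ⊕ T_j`, hence `0`. [cite: Hazama1983, §3 (p. 305)]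
[cite: Zarhin1983HodgeGroupsK3, §2] -/
theorem SymplecticBlocks.eq_zero_of_forall_block (H : HodgeStructure V n) (ψ : H.Polarization)
    (hself : ∀ a : H.endAlg, LinearMap.IsAdjointPair ψ.form ψ.form (a : Module.End ℚ V) (a : Module.End ℚ V))
    (σ : ι → (H.endAlg →+* ℂ)) (hint : DirectSum.IsInternal fun i => H.eigenBlock (σ i)) (i : ι) {x : ℂ ⊗[ℚ] V}
    (hx : x ∈ H.eigenBlock (σ i)) (h0 : ∀ y ∈ H.eigenBlock (σ i), ψ.form.baseChange ℂ x y = 0) : x = 0 := by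
  refine ψ.eq_zero_of_forall_form_eq_zero fun y => ?_
  have hy : y ∈ ⨆ j, H.eigenBlock (σ j) := by
    rw [hint.submodule_iSup_eq_top]
    exact Submodule.mem_top
  induction hy using Submodule.iSup_induction' with
  | mem j y hy =>
    by_cases hji : σ j = σ i
    · rw [hji] at hy
      exact h0 y hy
    · exact form_eq_zero_of_mem_eigenBlock_of_isAdjointPair H ψ hself (Ne.symm hji) hx hy
  | zero => simp
  | add y y' _ _ hy hy' => rw [map_add, hy, hy', add_zero]

/-! ### §2 The blocks are real and `Θ`-graded, with two-dimensional graded pieces -/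

omit [Module.Finite ℚ V] [HodgeTensorFacts.{u, u}] in
/-- A REAL character has a real block: `conj T_σ = T_σ`. [cite: Zarhin1983HodgeGroupsK3, §2] -/
theorem SymplecticBlocks.conj_mem_eigenBlock_of_real (H : HodgeStructure V n) {τ : H.endAlg →+* ℂ}
    (hreal : (starRingEnd ℂ).comp τ = τ) {x : ℂ ⊗[ℚ] V} (hx : x ∈ H.eigenBlock τ) : conj x ∈ H.eigenBlock τ := by
  have h := H.conj_mem_eigenBlock hx
  rwa [hreal] at h

omit [HodgeTensorFacts.{u, u}] in
/-- **The graded pieces `T ∩ V^{1,0}`, `T ∩ V^{0,1}` of a real, `Θ`-stable, four-dimensional subspace `T` are planes** (they are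
exchanged by the antilinear bijection `conj`, and `T` is their direct sum). [cite: VoisinHodgeI2002, §7.1.1 Def. 7.4]
[cite: Zarhin1983HodgeGroupsK3, §2] -/
theorem SymplecticBlocks.finrank_inf_piece_eq_two (H : HodgeStructure V n) (hn : n = 1) (heff : H.IsEffective)
    {Θ : Module.End ℂ (ℂ ⊗[ℚ] V)} (hΘ : ∀ p, ∀ x ∈ H.piece p (n - p), Θ x = ((2 * p - n : ℤ) : ℂ) • x)
    {T : Submodule ℂ (ℂ ⊗[ℚ] V)} (hTconj : ∀ x ∈ T, conj x ∈ T) (hΘT : ∀ x ∈ T, Θ x ∈ T) (hT4 : Module.finrank ℂ T = 4) :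
    Module.finrank ℂ ↥(T ⊓ H.piece 1 0) = 2 ∧ Module.finrank ℂ ↥(T ⊓ H.piece 0 1) = 2 := by
  subst hn
  obtain ⟨hP, hQ, hΘ10, hΘ01, -⟩ := UnitaryTheta.theta_facts H rfl heff hΘ
  have hPQv : ∀ v, (2 : ℂ)⁻¹ • (v + Θ v) + (2 : ℂ)⁻¹ • (v - Θ v) = v := fun v => by module
  -- `T = (T ∩ V^{1,0}) ⊕ (T ∩ V^{0,1})`
  have hsup : (T ⊓ H.piece 1 0) ⊔ (T ⊓ H.piece 0 1) = T := by
    refine le_antisymm (sup_le inf_le_left inf_le_left) fun v hv => ?_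
    rw [← hPQv v]
    exact Submodule.add_mem_sup
      ⟨Submodule.smul_mem _ _ (Submodule.add_mem _ hv (hΘT v hv)), hP v⟩
      ⟨Submodule.smul_mem _ _ (Submodule.sub_mem _ hv (hΘT v hv)), hQ v⟩
  have hinf : (T ⊓ H.piece 1 0) ⊓ (T ⊓ H.piece 0 1) = ⊥ := by
    rw [eq_bot_iff]
    rintro x ⟨⟨-, hx1⟩, ⟨-, hx2⟩⟩
    rw [Submodule.mem_bot]
    have h1 := hΘ10 x hx1
    rw [hΘ01 x hx2, neg_eq_iff_add_eq_zero, ← two_smul ℂ x, smul_eq_zero] at h1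
    exact h1.resolve_left (two_ne_zero' ℂ)
  have hsum := Submodule.finrank_sup_add_finrank_inf_eq (T ⊓ H.piece 1 0) (T ⊓ H.piece 0 1)
  rw [hsup, hinf, finrank_bot, add_zero, hT4] at hsum
  -- `conj` is an antilinear bijection between the two graded pieces
  have hsymm : Module.finrank ℂ ↥(T ⊓ H.piece 1 0) = Module.finrank ℂ ↥(T ⊓ H.piece 0 1) := by
    let e : ↥(T ⊓ H.piece 1 0) ≃+ ↥(T ⊓ H.piece 0 1) :=
      { toFun := fun x => ⟨conj x.1, hTconj _ x.2.1, conj_mem_piece H x.2.2⟩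
        invFun := fun x => ⟨conj x.1, hTconj _ x.2.1, conj_mem_piece H x.2.2⟩
        left_inv := fun x => by ext; simp [conj_conj]
        right_inv := fun x => by ext; simp [conj_conj]
        map_add' := fun x y => by ext; simp [map_add] }
    have he : ∀ (c : ℂ) (x : ↥(T ⊓ H.piece 1 0)), e (c • x) = starRingEnd ℂ c • e x := fun c x => by
      ext
      simp [e, conj_smul]
    unfold Module.finrank
    rw [rank_eq_of_equiv_equiv (starRingEnd ℂ) e (Function.Involutive.bijective fun c => starRingEnd_self_apply c) he]
  omega

/-! ### §3 The Lie algebra of restrictions to a block and its irreducibility -/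

/-- **The restrictions of `Lie Hg ⊗ ℂ` to a block act irreducibly** (relative to any family of restrictions that contains the
restriction of every `Y ∈ Lie Hg ⊗ ℂ`): a subspace `U ⊆ T_τ` stable under all of them is `0` or `T_τ` — the tree's positivity theorem
`eq_bot_or_forall_mem_of_hodgeLieC_stable` (the `h`-orthogonal projector onto `U` lies in `End_Hdg ⊗ ℂ`, a scalar on `T_τ`).
[cite: Zarhin1983HodgeGroupsK3, §2] -/
theorem SymplecticBlocks.eq_bot_or_top_of_stable (H : HodgeStructure V n) (ψ : H.Polarization) (τ : H.endAlg →+* ℂ)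
    (𝔊 : Submodule ℂ (Module.End ℂ ↥(H.eigenBlock τ)))
    (h𝔊 : ∀ Y ∈ H.hodgeLieC, ∃ g ∈ 𝔊, ∀ x : H.eigenBlock τ, ((g x : H.eigenBlock τ) : ℂ ⊗[ℚ] V) = Y x)
    (U : Submodule ℂ ↥(H.eigenBlock τ)) (hU : ∀ g ∈ 𝔊, ∀ u ∈ U, g u ∈ U) : U = ⊥ ∨ U = ⊤ := by
  set U' : Submodule ℂ (ℂ ⊗[ℚ] V) := U.map (H.eigenBlock τ).subtype with hU'
  have hU'le : U' ≤ H.eigenBlock τ := by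
    rintro _ ⟨u, -, rfl⟩
    exact u.2
  have hU'χ : ∀ x ∈ U', ∀ a : H.endAlg, (a : Module.End ℚ V).baseChange ℂ x = τ a • x :=
    fun x hx a => (H.mem_eigenBlock_iff τ x).1 (hU'le hx) a
  have hU'stab : ∀ Y ∈ H.hodgeLieC, ∀ x ∈ U', Y x ∈ U' := by
    rintro Y hY _ ⟨u, hu, rfl⟩
    obtain ⟨g, hg, hgY⟩ := h𝔊 Y hY
    exact ⟨g u, hU g hg u hu, hgY u⟩
  rcases eq_bot_or_forall_mem_of_hodgeLieC_stable ψ (fun a => τ a) hU'χ hU'stab with h | h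
  · left
    rw [eq_bot_iff]
    intro u hu
    rw [Submodule.mem_bot]
    have h1 : (u : ℂ ⊗[ℚ] V) ∈ U' := ⟨u, hu, rfl⟩
    rw [h, Submodule.mem_bot] at h1
    exact Subtype.ext h1
  · right
    rw [eq_top_iff]
    intro u _
    have hu : (u : ℂ ⊗[ℚ] V) ∈ U' := h u fun a => (H.mem_eigenBlock_iff τ u).1 u.2 a
    obtain ⟨u', hu', huu'⟩ := hu
    have : u' = u := Subtype.ext huu'
    rw [← this]
    exact hu'

/-! ### §4 The theorem: `{Y|_{T_i} : Y ∈ Lie Hg ⊗ ℂ} = 𝔰𝔭(T_i, ψ_ℂ|_{T_i})` on every four-dimensional real block -/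

/-- **Theorem (`Lie Hg ⊗ ℂ` restricts onto `𝔰𝔭(T_i)` on each four-dimensional real eigenblock; Moonen–Zarhin's Type I(2)
«`Hg = R_{F/ℚ} Sp_{4,F}`», per place).**  Let `H` be an effective polarized weight-one `ℚ`-Hodge structure such that every Hodge
endomorphism is `ψ`-self-adjoint, and `σ_i` real characters of `End_Hdg(V)` whose blocks `T_i` form an internal direct sum
`V_ℂ = ⊕ T_i` and are four-dimensional.  Then for every `i` and every `ℂ`-linear `g : T_i → T_i` which is skew for `ψ_ℂ|_{T_i}`
there is `Y ∈ Lie Hg(H) ⊗ ℂ` with `Y x = g x` for all `x ∈ T_i`.  Proof: the restrictions `𝔊_i = {Y|_{T_i}}` form a bracket-closed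
space of skew operators for the non-degenerate alternating `ω_i = ψ_ℂ|_{T_i}` (§1), containing the involution `Θ|_{T_i}` whose
eigenspaces are planes (§2), and acting irreducibly (§3); the core theorem `SymplecticTheta.core_of_irreducible` for `T = ±Θ|_{T_i}`
yields `𝔲^± ⊕ 𝔤𝔩(T_i ∩ V^{1,0}) ⊆ 𝔊_i`, i.e. `𝔊_i = 𝔰𝔭(T_i, ω_i)` along the `ad Θ`-grading.
[cite: MoonenZarhin1995Duke, Type I(2)] [cite: MoonenZarhin1999LowDim, §2 (2.2) and §3 (3.1)] [cite: GoodmanWallachGTM255, §2.1.2] -/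
theorem SymplecticBlocks.exists_mem_hodgeLieC_restrict_eq (H : HodgeStructure V n) (hn : n = 1) (heff : H.IsEffective)
    (ψ : H.Polarization)
    (hself : ∀ a : H.endAlg, LinearMap.IsAdjointPair ψ.form ψ.form (a : Module.End ℚ V) (a : Module.End ℚ V))
    (σ : ι → (H.endAlg →+* ℂ)) (hreal : ∀ i, (starRingEnd ℂ).comp (σ i) = σ i)
    (hint : DirectSum.IsInternal fun i => H.eigenBlock (σ i)) (h4 : ∀ i, Module.finrank ℂ (H.eigenBlock (σ i)) = 4) (i : ι) :
    ∀ g : Module.End ℂ ↥(H.eigenBlock (σ i)),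
      (∀ x y : H.eigenBlock (σ i), ψ.form.baseChange ℂ ((g x : H.eigenBlock (σ i)) : ℂ ⊗[ℚ] V) y +
        ψ.form.baseChange ℂ (x : ℂ ⊗[ℚ] V) ((g y : H.eigenBlock (σ i)) : ℂ ⊗[ℚ] V) = 0) →
      ∃ Y ∈ H.hodgeLieC, ∀ x : H.eigenBlock (σ i), ((g x : H.eigenBlock (σ i)) : ℂ ⊗[ℚ] V) = Y x := by
  classical
  subst hn
  set T := H.eigenBlock (σ i) with hT
  intro g hg
  -- the Hodge operator and its facts
  obtain ⟨Θ, hΘ⟩ := exists_hodgeTheta H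
  have hΘC : Θ ∈ H.hodgeLieC := H.mem_hodgeLieC_of_forall_piece hΘ
  obtain ⟨hPv, hQv, hΘ10, hΘ01, hΘΘ⟩ := UnitaryTheta.theta_facts H rfl heff hΘ
  have hYT : ∀ Y ∈ H.hodgeLieC, ∀ x ∈ T, Y x ∈ T := fun Y hY x hx => H.apply_mem_eigenBlock_of_mem_hodgeLieC hY hx
  -- the restricted form `ω`
  set ω : LinearMap.BilinForm ℂ ↥T := (ψ.form.baseChange ℂ).compl₁₂ T.subtype T.subtype with hω
  have hω_apply : ∀ x y : T, ω x y = ψ.form.baseChange ℂ (x : ℂ ⊗[ℚ] V) y := fun x y => rfl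
  have hsepL : ∀ x : T, (∀ y : T, ω x y = 0) → x = 0 := by
    intro x hx
    have h0 : (x : ℂ ⊗[ℚ] V) = 0 :=
      SymplecticBlocks.eq_zero_of_forall_block H ψ hself σ hint i x.2 fun y hy => by
        have h := hx ⟨y, hy⟩
        rwa [hω_apply] at h
    exact Subtype.ext h0
  have hωalt : ∀ x y : T, ω x y = -ω y x := fun x y => by
    rw [hω_apply, hω_apply, form_baseChange_swap_of_odd H odd_one ψ]
  have hωnd : ω.Nondegenerate := by
    refine ⟨fun x hx => hsepL x hx, fun y hy => hsepL y fun x => ?_⟩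
    rw [hωalt, hy x, neg_zero]
  -- the Lie algebra of restrictions
  let 𝔊 : Submodule ℂ (Module.End ℂ ↥T) :=
    { carrier := {g' | ∃ Y ∈ H.hodgeLieC, ∀ x : T, ((g' x : T) : ℂ ⊗[ℚ] V) = Y x}
      zero_mem' := ⟨0, Submodule.zero_mem _, fun x => by simp⟩
      add_mem' := by
        rintro g₁ g₂ ⟨Y₁, hY₁, h₁⟩ ⟨Y₂, hY₂, h₂⟩
        exact ⟨Y₁ + Y₂, Submodule.add_mem _ hY₁ hY₂, fun x => by
          rw [LinearMap.add_apply, Submodule.coe_add, h₁, h₂, LinearMap.add_apply]⟩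
      smul_mem' := by
        rintro c g' ⟨Y, hY, h⟩
        exact ⟨c • Y, Submodule.smul_mem _ c hY, fun x => by
          rw [LinearMap.smul_apply, Submodule.coe_smul, h, LinearMap.smul_apply]⟩ }
  have hmem𝔊 : ∀ g', g' ∈ 𝔊 ↔ ∃ Y ∈ H.hodgeLieC, ∀ x : T, ((g' x : T) : ℂ ⊗[ℚ] V) = Y x := fun g' => Iff.rfl
  -- every `Y ∈ Lie Hg ⊗ ℂ` restricts into `𝔊`
  have hrestr : ∀ Y ∈ H.hodgeLieC, ∃ g' ∈ 𝔊, ∀ x : T, ((g' x : T) : ℂ ⊗[ℚ] V) = Y x := fun Y hY =>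
    ⟨Y.restrict fun x hx => hYT Y hY x hx, (hmem𝔊 _).2 ⟨Y, hY, fun x => rfl⟩, fun x => rfl⟩
  have h𝔊br : ∀ g₁ ∈ 𝔊, ∀ g₂ ∈ 𝔊, g₁ * g₂ - g₂ * g₁ ∈ 𝔊 := by
    rintro g₁ ⟨Y₁, hY₁, h₁⟩ g₂ ⟨Y₂, hY₂, h₂⟩
    refine (hmem𝔊 _).2 ⟨Y₁ * Y₂ - Y₂ * Y₁, H.commutator_mem_hodgeLieC hY₁ hY₂, fun x => ?_⟩
    rw [LinearMap.sub_apply, Submodule.coe_sub, Module.End.mul_apply, Module.End.mul_apply, h₁, h₂, h₂, h₁,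
      LinearMap.sub_apply, Module.End.mul_apply, Module.End.mul_apply]
  have h𝔊skew : ∀ g' ∈ 𝔊, ∀ x y : T, ω (g' x) y + ω x (g' y) = 0 := by
    rintro g' ⟨Y, hY, h⟩ x y
    rw [hω_apply, hω_apply, h, h, formBaseChange_skew_of_mem_hodgeLieC ψ hY, neg_add_cancel]
  -- the involution `Θ|_T` and its eigen-planes
  set TΘ : Module.End ℂ ↥T := Θ.restrict fun x hx => hYT Θ hΘC x hx with hTΘ
  have hTΘ_coe : ∀ x : T, ((TΘ x : T) : ℂ ⊗[ℚ] V) = Θ x := fun x => rfl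
  have hTΘ𝔊 : TΘ ∈ 𝔊 := (hmem𝔊 _).2 ⟨Θ, hΘC, hTΘ_coe⟩
  have hTΘΘ : ∀ v : T, TΘ (TΘ v) = v := fun v => Subtype.ext (by rw [hTΘ_coe, hTΘ_coe, hΘΘ])
  set P : Submodule ℂ ↥T := (H.piece 1 0).comap T.subtype with hPdef
  set Q : Submodule ℂ ↥T := (H.piece 0 1).comap T.subtype with hQdef
  have hP : ∀ x ∈ P, TΘ x = x := fun x hx => Subtype.ext (by rw [hTΘ_coe]; exact hΘ10 _ hx)
  have hQ : ∀ x ∈ Q, TΘ x = -x := fun x hx => Subtype.ext (by rw [hTΘ_coe, Submodule.coe_neg]; exact hΘ01 _ hx)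
  have hPmem : ∀ v : T, (2 : ℂ)⁻¹ • (v + TΘ v) ∈ P := fun v => by
    change (((2 : ℂ)⁻¹ • (v + TΘ v) : T) : ℂ ⊗[ℚ] V) ∈ H.piece 1 0
    rw [Submodule.coe_smul, Submodule.coe_add, hTΘ_coe]
    exact hPv _
  have hQmem : ∀ v : T, (2 : ℂ)⁻¹ • (v - TΘ v) ∈ Q := fun v => by
    change (((2 : ℂ)⁻¹ • (v - TΘ v) : T) : ℂ ⊗[ℚ] V) ∈ H.piece 0 1
    rw [Submodule.coe_smul, Submodule.coe_sub, hTΘ_coe]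
    exact hQv _
  -- dimensions of the eigen-planes
  have hTconj : ∀ x ∈ T, conj x ∈ T := fun x hx => SymplecticBlocks.conj_mem_eigenBlock_of_real H (hreal i) hx
  obtain ⟨hP2', hQ2'⟩ := SymplecticBlocks.finrank_inf_piece_eq_two H rfl heff hΘ hTconj (hYT Θ hΘC) (h4 i)
  have hPeq : P = (T ⊓ H.piece 1 0).comap T.subtype := by
    ext x
    simp only [hPdef, Submodule.mem_comap, Submodule.coe_subtype, Submodule.mem_inf, SetLike.coe_mem, true_and]
  have hQeq : Q = (T ⊓ H.piece 0 1).comap T.subtype := by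
    ext x
    simp only [hQdef, Submodule.mem_comap, Submodule.coe_subtype, Submodule.mem_inf, SetLike.coe_mem, true_and]
  have hP2 : Module.finrank ℂ P = 2 := by
    rw [hPeq, (Submodule.comapSubtypeEquivOfLe (inf_le_left : T ⊓ H.piece 1 0 ≤ T)).finrank_eq, hP2']
  have hQ2 : Module.finrank ℂ Q = 2 := by
    rw [hQeq, (Submodule.comapSubtypeEquivOfLe (inf_le_left : T ⊓ H.piece 0 1 ≤ T)).finrank_eq, hQ2']
  -- irreducibility
  have hirr : ∀ U : Submodule ℂ ↥T, (∀ Z ∈ 𝔊, ∀ u ∈ U, Z u ∈ U) → U = ⊥ ∨ U = ⊤ :=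
    fun U hU => SymplecticBlocks.eq_bot_or_top_of_stable H ψ (σ i) 𝔊 hrestr U hU
  -- the core theorem for `T = Θ|_T` and `T = -Θ|_T`
  have hnΘ𝔊 : -TΘ ∈ 𝔊 := (hmem𝔊 _).2 ⟨-Θ, Submodule.neg_mem _ hΘC, fun x => by
    rw [LinearMap.neg_apply, Submodule.coe_neg, hTΘ_coe, LinearMap.neg_apply]⟩
  have hnΘΘ : ∀ v : T, (-TΘ) ((-TΘ) v) = v := fun v => by
    rw [LinearMap.neg_apply, LinearMap.neg_apply, map_neg, neg_neg, hTΘΘ]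
  have hP' : ∀ x ∈ Q, (-TΘ) x = x := fun x hx => by rw [LinearMap.neg_apply, hQ x hx, neg_neg]
  have hQ' : ∀ x ∈ P, (-TΘ) x = -x := fun x hx => by rw [LinearMap.neg_apply, hP x hx]
  have hPmem' : ∀ v : T, (2 : ℂ)⁻¹ • (v + (-TΘ) v) ∈ Q := fun v => by
    rw [LinearMap.neg_apply, ← sub_eq_add_neg]; exact hQmem v
  have hQmem' : ∀ v : T, (2 : ℂ)⁻¹ • (v - (-TΘ) v) ∈ P := fun v => by
    rw [LinearMap.neg_apply, sub_neg_eq_add]; exact hPmem v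
  obtain ⟨hA, hB⟩ := SymplecticTheta.core_of_irreducible ω hωnd hωalt 𝔊 h𝔊br h𝔊skew hTΘ𝔊 hTΘΘ
    (P := P) (Q := Q) hP hQ hPmem hQmem hP2 hQ2 hirr
  obtain ⟨hA', -⟩ := SymplecticTheta.core_of_irreducible ω hωnd hωalt 𝔊 h𝔊br h𝔊skew hnΘ𝔊 hnΘΘ
    (P := Q) (Q := P) hP' hQ' hPmem' hQmem' hQ2 hP2 hirr
  -- the space of `ω`-skew operators on `T` and the grading of `g`
  let 𝔰 : Submodule ℂ (Module.End ℂ ↥T) :=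
    { carrier := {Z | ∀ x y : T, ω (Z x) y + ω x (Z y) = 0}
      zero_mem' := fun x y => by simp
      add_mem' := by
        intro Z Z' hZ hZ' x y
        simp only [LinearMap.add_apply, map_add]
        have h1 := hZ x y
        have h2 := hZ' x y
        linear_combination h1 + h2
      smul_mem' := by
        intro c Z hZ x y
        simp only [LinearMap.smul_apply, map_smul, smul_eq_mul]
        have h1 := hZ x y
        linear_combination c * h1 }
  have hmem𝔰 : ∀ Z, Z ∈ 𝔰 ↔ ∀ x y : T, ω (Z x) y + ω x (Z y) = 0 := fun Z => Iff.rfl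
  have h𝔰br : ∀ Z ∈ 𝔰, ∀ Z' ∈ 𝔰, Z * Z' - Z' * Z ∈ 𝔰 := by
    intro Z hZ Z' hZ' x y
    simp only [LinearMap.sub_apply, Module.End.mul_apply, map_sub, LinearMap.sub_apply]
    have h1 := (hmem𝔰 Z).1 hZ (Z' x) y
    have h2 := (hmem𝔰 Z').1 hZ' x (Z y)
    have h3 := (hmem𝔰 Z').1 hZ' (Z x) y
    have h4 := (hmem𝔰 Z).1 hZ x (Z' y)
    linear_combination h1 - h3 + h4 - h2
  have hΘ𝔰 : TΘ ∈ 𝔰 := (hmem𝔰 TΘ).2 (h𝔊skew TΘ hTΘ𝔊)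
  have hg𝔰 : g ∈ 𝔰 := (hmem𝔰 g).2 fun x y => by rw [hω_apply, hω_apply]; exact hg x y
  obtain ⟨Ym, hYm, Y0, hY0, Yp, hYp, hYeq, hYpP, hYpim, hYmQ, hYmim, -, -, hY0P, hY0Q⟩ :=
    SymplecticTheta.exists_decomp 𝔰 h𝔰br hΘ𝔰 hTΘΘ (P := P) (Q := Q) hP hQ hPmem hQmem hg𝔰
  have hg𝔊 : g ∈ 𝔊 := by
    rw [hYeq]
    refine Submodule.add_mem _ (Submodule.add_mem _ ?_ ?_) ?_
    · exact hA' Ym ((hmem𝔰 Ym).1 hYm) hYmQ hYmim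
    · exact hB Y0 ((hmem𝔰 Y0).1 hY0) hY0P hY0Q
    · exact hA Yp ((hmem𝔰 Yp).1 hYp) hYpP hYpim
  exact (hmem𝔊 g).1 hg𝔊

end HodgeStructure

end Literature.AlgebraicGeometry.Motives

end
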